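import Mathlib.LinearAlgebra.PerfectPairing.Basic
import Mathlib.RingTheory.Finiteness.Defs
import Mathlib.Algebra.Ring.NegOnePow
import Mathlib.LinearAlgebra.Dimension.Finrank
import Mathlib.AlgebraicGeometry.ResidueField
import Literature.AlgebraicGeometry.Motives.Varieties
import Literature.AlgebraicGeometry.Motives.Cycles
import Literature.AlgebraicGeometry.Motives.PreWeilCohomology
import HarnessLib

-- provenance: harness21/H21/H21/Prelude/MotiveAbstract/WeilCohomology.lean @ cda1ccb (interim HEAD d8f2665); M5 mechanical rewrite
/-!
# Weil cohomology theories: the axioms (trunk MotiveAbstract, prelude C9)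

Following Kleiman, *Algebraic cycles and the Weil conjectures* (1968), §1.2 (compare
Grothendieck 1969 and Stacks 0FFG), a **Weil cohomology theory** on smooth projective
`k`-varieties with coefficients in a field `K` of characteristic zero is the data of
`Literature.PreWeilCohomology k K` (functors `Hⁱ`, cup product, unit, trace, cycle classes) subject to:

* `H•(X)` is a graded-commutative `K`-algebra, functorially in `X`
  (`cup_assoc`, `cup_comm`, `one_cup`, `map_one`, `map_cup`);
* **(A) Poincaré duality**: each `Hⁱ(X)` is finite dimensional, `Hⁱ(X) = 0` for `i > 2 dim X`,
  the trace `H²ⁿ(X) → K` is an isomorphism and `(x, y) ↦ tr (x ∪ y)` is a perfect pairing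
  `Hⁱ(X) × H²ⁿ⁻ⁱ(X) → K` (`finite_obj`, `subsingleton_obj`, `bijective_trace`,
  `isPerfPair_cupPairing`);
* **(B) Künneth**: `⨁_{i+j=n} Hⁱ(X) ⊗ Hʲ(Y) → Hⁿ(X × Y)` is bijective and the trace is
  multiplicative (`bijective_kunnethMap`, `trace_externalCup`);
* **(C) cycle map**, in a *light* form ("C-lite"): the class of `X` is `1`, the class of a closed
  point is its degree, rationally trivial cycles have class `0`, pull-backs / cup products /
  algebraic correspondences preserve (rational) algebraic classes, the diagonal induces the
  identity and the transpose of a graph induces `f*`, hyperplane classes exist and have positive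
  degree (see the field docstrings).

**Omitted axioms** (recorded, Kleiman 1968 §1.2 (C)): the compatibility of the cycle map with the
*intersection product* of cycles (`cl(Z · Z') = cl(Z) ∪ cl(Z')`) and with *flat pull-back* and
*proper push-forward* of cycles (`f* cl = cl f*`, `f₊ cl = cl f₊`). Stating them needs an
intersection theory of cycles and flat pull-back of cycles, which the H21 prelude does not build
(cf. `Literature.Prelude.MotiveAbstract.Cycles`). The C-lite fields are exactly the *cohomological
shadows* of these axioms that the standard conjectures and the Lefschetz-type theorems consume.

## Main definitions

* `Literature.WeilCohomology k K` : the structure of axioms, extending `Literature.PreWeilCohomology k K`.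
* `W.HasHardLefschetz` : the hard Lefschetz property for every smooth projective `X` and every
  hyperplane class (Kleiman 1968 §1.4).
* `W.IsHomologicallyTrivial X p c`, `W.IsNumericallyTrivial n X p c` : homological and numerical
  triviality of a codimension-`p` cycle (Kleiman 1968 §3.1).
* `W.chowGroupCycleMap hX h : ChowGroup X.left d →+ H²ᵖ(X)` : the cycle map descended to the
  Chow group (`p + d = n`), a real definition via `QuotientAddGroup.lift`.

## Design choices

* Every axiom is a `Prop`-valued field quantified as `∀ ⦃n X⦄, IsSmoothProjective n X → …`: the
  data of `PreWeilCohomology` is defined on all `k`-schemes, but only constrained on smooth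
  projective varieties (of the stated dimension `n`).
* Degrees are natural numbers; degree constraints are explicit equations (cast-free), discharged
  by `omega` where they are forced.
* Mathlib has no Weil cohomology theory (searched `WeilCohomology`, `Kunneth`, `PoincareDuality`
  in `Mathlib/AlgebraicGeometry`: nothing). We use Mathlib's `LinearMap.IsPerfPair`,
  `Module.Finite`, `Module.finrank`, `Int.negOnePow`, `Scheme.Hom.residueDegree`,
  `QuotientAddGroup.lift`.

## References

* S. Kleiman, *Algebraic cycles and the Weil conjectures*, in: Dix exposés sur la cohomologie des
  schémas (1968), §1.2 (axioms), §1.4 (Lefschetz), §3.1 (equivalence relations on cycles).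
* A. Grothendieck, *Standard conjectures on algebraic cycles* (1969).
* The Stacks project, Tag 0FFG.
-/

universe u v

open CategoryTheory AlgebraicGeometry MonoidalCategory CartesianMonoidalCategory Opposite
open scoped TensorProduct DirectSum

noncomputable section

namespace Literature.AlgebraicGeometry.Motives

/-- A **Weil cohomology theory** on smooth projective `k`-varieties with coefficients in a field
`K` of characteristic zero (Kleiman 1968, §1.2; Grothendieck 1969; Stacks 0FFG): the data of a
`PreWeilCohomology` such that, for every smooth projective `X` of dimension `n`, `H•(X)` is a
finite-dimensional graded-commutative `K`-algebra vanishing above degree `2n`, satisfying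
Poincaré duality (A), the Künneth formula (B), and the *cohomological shadows* of Kleiman's
cycle-map postulate (C): normalisation of the classes of `X` and of closed points, factorisation
through rational equivalence, stability of rational algebraic classes under pull-back, cup
product and algebraic correspondences, algebraicity of the diagonal and of transposed graphs,
and existence and positivity of degree of hyperplane classes.

**Omitted** from Kleiman's axiom (C): compatibility of the cycle map with the intersection
product of cycles and with flat pull-back / proper push-forward of cycles (no intersection
theory of cycles is available in the prelude); the fields `pullback_ratAlgebraicClasses_le`,
`cup_mem_ratAlgebraicClasses`, `map_ratAlgebraicClasses_of_isInducedBy`, `exists_isInducedBy_id`,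
`exists_isInducedBy_pullback`, `trace_pow_of_isHyperplaneClass` are their consequences that the
theory of correspondences and the standard conjectures actually use. [cite: Kleiman1968, §1.2] -/
structure WeilCohomology (k : Type u) [Field k] (K : Type v) [Field K] [CharZero K]
    extends PreWeilCohomology k K where
  /-- The cup product is associative: `(a ∪ b) ∪ c = a ∪ (b ∪ c)` (Kleiman §1.2). -/
  cup_assoc : ∀ ⦃n : ℕ⦄ ⦃X : SchemeOver k⦄, IsSmoothProjective n X →
    ∀ ⦃i j l ij jl m : ℕ⦄ (hij : i + j = ij) (hjl : j + l = jl) (h₁ : ij + l = m)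
      (h₂ : i + jl = m) (a : toPreWeilCohomology.obj X i) (b : toPreWeilCohomology.obj X j)
      (c : toPreWeilCohomology.obj X l), cup h₁ (cup hij a b) c = cup h₂ a (cup hjl b c)
  /-- The cup product is graded-commutative: `a ∪ b = (-1)^{ij} b ∪ a` for `a ∈ Hⁱ`, `b ∈ Hʲ`
  (Kleiman §1.2, "anticommutative"). -/
  cup_comm : ∀ ⦃n : ℕ⦄ ⦃X : SchemeOver k⦄, IsSmoothProjective n X →
    ∀ ⦃i j m : ℕ⦄ (h : i + j = m) (h' : j + i = m) (a : toPreWeilCohomology.obj X i)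
      (b : toPreWeilCohomology.obj X j),
      cup h a b = ((i * j : ℤ).negOnePow : ℤ) • cup h' b a
  /-- `1 ∪ a = a` (Kleiman §1.2). -/
  one_cup : ∀ ⦃n : ℕ⦄ ⦃X : SchemeOver k⦄, IsSmoothProjective n X →
    ∀ ⦃i : ℕ⦄ (h : 0 + i = i) (a : toPreWeilCohomology.obj X i), cup h (one X) a = a
  /-- Pull-back preserves the unit: `f* 1 = 1` (Kleiman §1.2). -/
  map_one : ∀ ⦃n : ℕ⦄ ⦃X : SchemeOver k⦄, IsSmoothProjective n X →
    ∀ ⦃m : ℕ⦄ ⦃Y : SchemeOver k⦄, IsSmoothProjective m Y → ∀ f : X ⟶ Y,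
      toPreWeilCohomology.pullback f 0 (one Y) = one X
  /-- Pull-back is multiplicative: `f* (a ∪ b) = f* a ∪ f* b` (Kleiman §1.2). -/
  map_cup : ∀ ⦃n : ℕ⦄ ⦃X : SchemeOver k⦄, IsSmoothProjective n X →
    ∀ ⦃m : ℕ⦄ ⦃Y : SchemeOver k⦄, IsSmoothProjective m Y → ∀ (f : X ⟶ Y) ⦃i j l : ℕ⦄
      (h : i + j = l) (a : toPreWeilCohomology.obj Y i) (b : toPreWeilCohomology.obj Y j),
      toPreWeilCohomology.pullback f l (cup h a b) =
        cup h (toPreWeilCohomology.pullback f i a) (toPreWeilCohomology.pullback f j b)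
  /-- (A) Each `Hⁱ(X)` is a finite-dimensional `K`-vector space (Kleiman §1.2 (A)). -/
  finite_obj : ∀ ⦃n : ℕ⦄ ⦃X : SchemeOver k⦄, IsSmoothProjective n X →
    ∀ i : ℕ, Module.Finite K (toPreWeilCohomology.obj X i)
  /-- (A) `Hⁱ(X) = 0` for `i > 2 dim X` (Kleiman §1.2 (A)). -/
  subsingleton_obj : ∀ ⦃n : ℕ⦄ ⦃X : SchemeOver k⦄, IsSmoothProjective n X →
    ∀ ⦃i : ℕ⦄, 2 * n < i → Subsingleton (toPreWeilCohomology.obj X i)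
  /-- (A) The trace `H²ⁿ(X) → K` is an isomorphism, `n = dim X` (Kleiman §1.2 (A),
  orientation). -/
  bijective_trace : ∀ ⦃n : ℕ⦄ ⦃X : SchemeOver k⦄, IsSmoothProjective n X →
    Function.Bijective (trace X n)
  /-- (A) Poincaré duality: `Hⁱ(X) × H²ⁿ⁻ⁱ(X) → K`, `(x, y) ↦ tr (x ∪ y)` is a perfect pairing
  (Kleiman §1.2 (A)). -/
  isPerfPair_cupPairing : ∀ ⦃n : ℕ⦄ ⦃X : SchemeOver k⦄, IsSmoothProjective n X →
    ∀ (i j : ℕ) (h : i + j = 2 * n), (toPreWeilCohomology.cupPairing X n i j h).IsPerfPair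
  /-- (B) Künneth formula: `⨁_{i+j=d} Hⁱ(X) ⊗ Hʲ(Y) → Hᵈ(X × Y)` is bijective
  (Kleiman §1.2 (B)). -/
  bijective_kunnethMap : ∀ ⦃n : ℕ⦄ ⦃X : SchemeOver k⦄, IsSmoothProjective n X →
    ∀ ⦃m : ℕ⦄ ⦃Y : SchemeOver k⦄, IsSmoothProjective m Y →
      ∀ d : ℕ, Function.Bijective (toPreWeilCohomology.kunnethMap X Y d)
  /-- (B) The trace is multiplicative: `tr_{X×Y} (pr₁* a ∪ pr₂* b) = tr_X a · tr_Y b`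
  (Kleiman §1.2 (B)). -/
  trace_externalCup : ∀ ⦃n : ℕ⦄ ⦃X : SchemeOver k⦄, IsSmoothProjective n X →
    ∀ ⦃m : ℕ⦄ ⦃Y : SchemeOver k⦄, IsSmoothProjective m Y →
      ∀ (a : toPreWeilCohomology.obj X (2 * n)) (b : toPreWeilCohomology.obj Y (2 * m)),
      trace (X ⊗ Y) (n + m) (toPreWeilCohomology.externalCup X Y (mul_add 2 n m).symm a b) =
        trace X n a * trace Y m b
  /-- (C-lite) The class of `X` itself (the prime cycle of the generic point, codimension `0`)
  is the unit `1 ∈ H⁰(X)` (Kleiman §1.2 (C), `γ_X [X] = 1`). -/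
  cycleClass_of_coheight_eq_zero : ∀ ⦃n : ℕ⦄ ⦃X : SchemeOver k⦄, IsSmoothProjective n X →
    ∀ z : X.left, Order.coheight z = 0 → cycleClass X 0 z = one X
  /-- (C-lite) The trace of the class of a closed point `z` is its degree `[κ(z) : k]`
  (Kleiman §1.2 (C), `tr_P = γ_P⁻¹` for a point `P`, together with push-forward). -/
  trace_cycleClass : ∀ ⦃n : ℕ⦄ ⦃X : SchemeOver k⦄, IsSmoothProjective n X →
    ∀ z : X.left, Order.coheight z = n →
      trace X n (cycleClass X n z) = (X.hom.residueDegree z : K)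
  /-- (C-lite) The cycle map kills cycles rationally equivalent to zero, i.e. factors through the
  Chow group `CH_d X = CHᵖ X`, `p + d = dim X` (Kleiman §1.2 (C) with Fulton §19.1). -/
  cycleMap_eq_zero_of_mem_ratTrivial : ∀ ⦃n : ℕ⦄ ⦃X : SchemeOver k⦄, IsSmoothProjective n X →
    ∀ (p d : ℕ), p + d = n → ∀ c : AlgebraicCycle X.left ℤ, c ∈ ratTrivial X.left d →
      toPreWeilCohomology.cycleMap X p c = 0
  /-- (C-lite) The junk values of `cycleClass` vanish: `cycleClass X p z = 0` unless `z` has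
  codimension `p` (so that `cycleMap X p` only sees the codimension-`p` part of a cycle). -/
  cycleClass_eq_zero_of_coheight_ne : ∀ ⦃n : ℕ⦄ ⦃X : SchemeOver k⦄, IsSmoothProjective n X →
    ∀ (p : ℕ) (z : X.left), Order.coheight z ≠ p → cycleClass X p z = 0
  /-- (C-lite) Pull-backs of rational algebraic classes are rational algebraic classes
  (shadow of `f* γ = γ f*`, Kleiman §1.2 (C)). -/
  pullback_ratAlgebraicClasses_le : ∀ ⦃n : ℕ⦄ ⦃X : SchemeOver k⦄, IsSmoothProjective n X →
    ∀ ⦃m : ℕ⦄ ⦃Y : SchemeOver k⦄, IsSmoothProjective m Y → ∀ (f : X ⟶ Y) (p : ℕ),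
      (toPreWeilCohomology.ratAlgebraicClasses Y p).map
          (toPreWeilCohomology.pullback f (2 * p)).toAddMonoidHom ≤
        toPreWeilCohomology.ratAlgebraicClasses X p
  /-- (C-lite) Cup products of rational algebraic classes are rational algebraic classes
  (shadow of `γ (Z · Z') = γ Z ∪ γ Z'`, Kleiman §1.2 (C)). -/
  cup_mem_ratAlgebraicClasses : ∀ ⦃n : ℕ⦄ ⦃X : SchemeOver k⦄, IsSmoothProjective n X →
    ∀ ⦃p q r : ℕ⦄ (h : p + q = r) (a b : _),
      a ∈ toPreWeilCohomology.ratAlgebraicClasses X p →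
      b ∈ toPreWeilCohomology.ratAlgebraicClasses X q →
      cup (show 2 * p + 2 * q = 2 * r by omega) a b ∈
        toPreWeilCohomology.ratAlgebraicClasses X r
  /-- (C-lite) A linear map `H²ᵖ(X) → H²q(Y)` induced by a rational algebraic correspondence
  `u ∈ A^c(X × Y) ⊗ ℚ` sends rational algebraic classes to rational algebraic classes
  (Kleiman §1.3, "algebraic correspondences preserve algebraic cycles"). -/
  map_ratAlgebraicClasses_of_isInducedBy : ∀ ⦃n : ℕ⦄ ⦃X : SchemeOver k⦄,
    IsSmoothProjective n X → ∀ ⦃m : ℕ⦄ ⦃Y : SchemeOver k⦄, IsSmoothProjective m Y →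
      ∀ ⦃c p q j' : ℕ⦄ (u : toPreWeilCohomology.obj (X ⊗ Y) (2 * c))
        (T : toPreWeilCohomology.obj X (2 * p) →ₗ[K] toPreWeilCohomology.obj Y (2 * q))
        (hj : 2 * q + j' = 2 * m) (hm : 2 * p + 2 * c + j' = 2 * (n + m)),
        u ∈ toPreWeilCohomology.ratAlgebraicClasses (X ⊗ Y) c →
        toPreWeilCohomology.IsInducedBy n m u T hj hm →
        ∀ a ∈ toPreWeilCohomology.ratAlgebraicClasses X p,
          T a ∈ toPreWeilCohomology.ratAlgebraicClasses Y q
  /-- (C-lite) The class of the diagonal `Δ ∈ Aⁿ(X × X) ⊗ ℚ` induces the identity of every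
  `Hⁱ(X)` (Kleiman §1.3, `Δ* = id`). -/
  exists_isInducedBy_id : ∀ ⦃n : ℕ⦄ ⦃X : SchemeOver k⦄, IsSmoothProjective n X →
    ∃ u ∈ toPreWeilCohomology.ratAlgebraicClasses (X ⊗ X) n,
      ∀ (i j' : ℕ) (hj : i + j' = 2 * n),
        toPreWeilCohomology.IsInducedBy n n u
          (LinearMap.id : toPreWeilCohomology.obj X i →ₗ[K] toPreWeilCohomology.obj X i) hj
          (show i + 2 * n + j' = 2 * (n + n) by omega)
  /-- (C-lite) For `f : X ⟶ Y`, the class of the transposed graph `ᵗΓ_f ∈ Aᵐ(Y × X) ⊗ ℚ`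
  (`m = dim Y`) induces `f* : Hⁱ(Y) → Hⁱ(X)` for every `i` (Kleiman §1.3). -/
  exists_isInducedBy_pullback : ∀ ⦃n : ℕ⦄ ⦃X : SchemeOver k⦄, IsSmoothProjective n X →
    ∀ ⦃m : ℕ⦄ ⦃Y : SchemeOver k⦄, IsSmoothProjective m Y → ∀ f : X ⟶ Y,
      ∃ u ∈ toPreWeilCohomology.ratAlgebraicClasses (Y ⊗ X) m,
        ∀ (i j' : ℕ) (hj : i + j' = 2 * n),
          toPreWeilCohomology.IsInducedBy m n u (toPreWeilCohomology.pullback f i) hj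
            (show i + 2 * m + j' = 2 * (m + n) by omega)
  /-- (C-lite) A smooth projective variety of positive dimension carries a hyperplane class
  (Kleiman §1.4; a hyperplane of the ambient `ℙᴺ` pulled back). -/
  isHyperplaneClass_nonempty : ∀ ⦃n : ℕ⦄ ⦃X : SchemeOver k⦄, IsSmoothProjective n X →
    1 ≤ n → ∃ η, toPreWeilCohomology.IsHyperplaneClass X η
  /-- (C-lite) The degree of `X` with respect to a hyperplane class is a positive integer:
  `tr_X (ηⁿ) = deg X > 0` (Kleiman §1.2 (C) with Bézout; the one numerical shadow of
  "cup product = intersection product" needed by the Lefschetz-type theorems). -/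
  trace_pow_of_isHyperplaneClass : ∀ ⦃n : ℕ⦄ ⦃X : SchemeOver k⦄, IsSmoothProjective n X →
    ∀ η, toPreWeilCohomology.IsHyperplaneClass X η →
      ∃ d : ℕ, 0 < d ∧ trace X n (toPreWeilCohomology.pow X η n) = d

namespace WeilCohomology

variable {k : Type u} [Field k] {K : Type v} [Field K] [CharZero K]

/-! ## Derived notions -/

/-- The **hard Lefschetz property** of a Weil cohomology theory: for every smooth projective `X`
of dimension `n`, every hyperplane class `η ∈ H²(X)` and `i + r = n`, the iterated Lefschetz
operator `Lʳ = (· ∪ ηʳ) : Hⁱ(X) → H²ⁿ⁻ⁱ(X)` is bijective (Kleiman 1968 §1.4; a theorem for the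
classical theories, Deligne 1980 in positive characteristic).

This is a *property of the theory `W`* (its subject `W` is an explicit binder), used downstream
only as a hypothesis `(hL : W.HasHardLefschetz)`; it is not asserted for every `W`.
[cite: Kleiman1968, §1.4] -/
def HasHardLefschetz (W : WeilCohomology k K) : Prop :=
  ∀ ⦃n : ℕ⦄ ⦃X : SchemeOver k⦄, IsSmoothProjective n X →
    ∀ η : W.obj X 2, W.IsHyperplaneClass X η →
      ∀ (i r j : ℕ), i + r = n → ∀ h : i + 2 * r = j,
        Function.Bijective (W.lefschetzPow X η r i j h)

/-- Unfolding lemma for `HasHardLefschetz`: bijectivity of every iterated Lefschetz operator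
`Lʳ : Hⁱ(X) → Hⁱ⁺²ʳ(X)`, `i + r = dim X`, for every hyperplane class. [cite: Kleiman1968, §1.4] -/
theorem hasHardLefschetz_iff (W : WeilCohomology k K) :
    W.HasHardLefschetz ↔
      ∀ ⦃n : ℕ⦄ ⦃X : SchemeOver k⦄, IsSmoothProjective n X →
        ∀ η : W.obj X 2, W.IsHyperplaneClass X η →
          ∀ (i r j : ℕ), i + r = n → ∀ h : i + 2 * r = j,
            Function.Bijective (W.lefschetzPow X η r i j h) :=
  Iff.rfl

/-- Under hard Lefschetz, each `Lʳ : Hⁱ(X) → Hⁱ⁺²ʳ(X)` with `i + r = dim X` is bijective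
(the eliminator form of `HasHardLefschetz`). [cite: Kleiman1968, §1.4] -/
theorem HasHardLefschetz.bijective_lefschetzPow {W : WeilCohomology k K}
    (hL : W.HasHardLefschetz) {n : ℕ} {X : SchemeOver k} (hX : IsSmoothProjective n X)
    {η : W.obj X 2} (hη : W.IsHyperplaneClass X η) {i r j : ℕ} (hir : i + r = n)
    (h : i + 2 * r = j) : Function.Bijective (W.lefschetzPow X η r i j h) :=
  hL hX η hη i r j hir h

variable (W : WeilCohomology k K)

/-- A cycle `c` on `X`, regarded in codimension `p`, is *homologically trivial* (for `W`) if its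
cohomology class `γ(c) ∈ H²ᵖ(X)` vanishes (Kleiman 1968 §3.1, `Z ∼_hom 0`). [cite: Kleiman1968, §3.1 (Z ∼_hom 0)] -/
def IsHomologicallyTrivial (X : SchemeOver k) (p : ℕ) (c : AlgebraicCycle X.left ℤ) : Prop :=
  W.cycleMap X p c = 0

/-- A cycle `c` on `X` (of dimension `n`), regarded in codimension `p`, is *numerically trivial*
(for `W`) if `tr_X (γ(c) ∪ γ(c')) = 0` for every codimension-`q` cycle `c'`, `p + q = n`
(Kleiman 1968 §3.1, `Z ∼_num 0`; the intersection number computed cohomologically). [cite: Kleiman1968, §3.1 (Z ∼_num 0)] -/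
def IsNumericallyTrivial (n : ℕ) (X : SchemeOver k) (p : ℕ) (c : AlgebraicCycle X.left ℤ) :
    Prop :=
  ∀ (q : ℕ) (h : p + q = n), ∀ c' ∈ cyclesOfCodim X.left q,
    W.cupPairing X n (2 * p) (2 * q) (by omega) (W.cycleMap X p c) (W.cycleMap X q c') = 0

/-- Homologically trivial cycles are numerically trivial (Kleiman 1968 Prop. 3.2 (i), the
trivial direction). [cite: Kleiman1968, Prop. 3.2 (i)] -/
theorem isNumericallyTrivial_of_isHomologicallyTrivial {n : ℕ} {X : SchemeOver k} {p : ℕ}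
    {c : AlgebraicCycle X.left ℤ} (hc : W.IsHomologicallyTrivial X p c) :
    W.IsNumericallyTrivial n X p c := by
  intro q h c' _
  rw [show W.cycleMap X p c = 0 from hc, LinearMap.map_zero, LinearMap.zero_apply]

section ChowGroup

variable {n : ℕ} {X : SchemeOver k}

/-- The cycle map on `d`-cycles of a (quasi-)compact `k`-scheme, as a group homomorphism
`Z_d X →+ H²ᵖ(X)` (additive since `X` is quasi-compact). Auxiliary for `chowGroupCycleMap`.
Compactness of a smooth projective `X` is the named fact `IsSmoothProjective.compactSpace`
(`Varieties`), so it is an instance hypothesis `[CompactSpace X.left]` here. [folklore] -/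
def cyclesOfDimCycleMap [CompactSpace X.left] (p d : ℕ) :
    ↥(cyclesOfDim X.left d) →+ W.obj X (2 * p) where
  toFun c := W.cycleMap X p c
  map_zero' := W.cycleMap_zero X p
  map_add' c c' := W.cycleMap_add X p c c'

/-- `cyclesOfDimCycleMap` is `cycleMap` on underlying cycles. [folklore] -/
@[simp]
lemma cyclesOfDimCycleMap_apply [CompactSpace X.left] (p d : ℕ)
    (c : ↥(cyclesOfDim X.left d)) : W.cyclesOfDimCycleMap p d c = W.cycleMap X p c := rfl

/-- The cycle map descended to the Chow group, `γ : CH_d X = CHᵖ X →+ H²ᵖ(X)` for a smooth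
projective `X` of dimension `n = p + d` (Kleiman 1968 §1.2 (C); Fulton §19.1). Well defined by
the axiom `cycleMap_eq_zero_of_mem_ratTrivial`.  The instance hypothesis `[CompactSpace X.left]`
is supplied, for smooth projective `X`, by the named fact `IsSmoothProjective.compactSpace`
(`Varieties`). [cite: Kleiman1968, §1.2 (C)] -/
def chowGroupCycleMap (hX : IsSmoothProjective n X) [CompactSpace X.left] {p d : ℕ}
    (h : p + d = n) : ChowGroup X.left d →+ W.obj X (2 * p) :=
  QuotientAddGroup.lift _ (W.cyclesOfDimCycleMap p d) fun c hc ↦ by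
    rw [AddMonoidHom.mem_ker, cyclesOfDimCycleMap_apply]
    exact W.cycleMap_eq_zero_of_mem_ratTrivial hX p d h c (AddSubgroup.mem_addSubgroupOf.mp hc)

/-- `γ [c] = γ c` on the class of a `d`-cycle. [folklore] -/
@[simp]
lemma chowGroupCycleMap_mk (hX : IsSmoothProjective n X) [CompactSpace X.left] {p d : ℕ}
    (h : p + d = n) (c : ↥(cyclesOfDim X.left d)) :
    W.chowGroupCycleMap hX h (ChowGroup.mk X.left d c) = W.cycleMap X p c := rfl

/-- The algebraic lattice `Aᵖ(X) ⊆ H²ᵖ(X)` is the image of the Chow group `CH_d X`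
(`p + d = dim X`) under the cycle map (Kleiman 1968 §1.2 (C), §1.4). Uses
`cyclesOfCodim_eq_cyclesOfDim` and `cycleClass_eq_zero_of_coheight_ne`. [cite: Kleiman1968, §1.2 (C)] -/
def algebraicLattice_eq_range_chowGroupCycleMap : Prop :=
  ∀ (hX : IsSmoothProjective n X) [CompactSpace X.left] {p d : ℕ} (h : p + d = n),
    W.algebraicLattice X p = (W.chowGroupCycleMap hX h).range

end ChowGroup

/-! ## Sanity statements -/

section Sanity

variable {n : ℕ} {X : SchemeOver k}

/-- `Hⁱ(X) = 0` for `i > 2 dim X`, in terms of `finrank` (Kleiman 1968 §1.2 (A)). [cite: Kleiman1968, §1.2 (A)] -/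
theorem finrank_obj_eq_zero (hX : IsSmoothProjective n X) {i : ℕ} (hi : 2 * n < i) :
    Module.finrank K (W.obj X i) = 0 := by
  haveI := W.subsingleton_obj hX hi
  exact Module.finrank_zero_of_subsingleton

/-- `H²ⁿ(X)` is one dimensional, `n = dim X` (the trace is an isomorphism onto `K`;
Kleiman 1968 §1.2 (A)). [cite: Kleiman1968, §1.2 (A)] -/
theorem finrank_obj_two_mul (hX : IsSmoothProjective n X) :
    Module.finrank K (W.obj X (2 * n)) = 1 := by
  rw [← Module.finrank_self K]
  exact LinearEquiv.finrank_eq (LinearEquiv.ofBijective (W.trace X n) (W.bijective_trace hX))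

/-- Poincaré duality symmetry of Betti numbers: `dim Hⁱ(X) = dim H²ⁿ⁻ⁱ(X)`
(Kleiman 1968 §1.2 (A); Mathlib `Module.finrank_of_isPerfPair`). [cite: Kleiman1968, §1.2 (A)] -/
theorem finrank_obj_eq_of_add_eq (hX : IsSmoothProjective n X) {i j : ℕ} (h : i + j = 2 * n) :
    Module.finrank K (W.obj X i) = Module.finrank K (W.obj X j) := by
  haveI := W.finite_obj hX i
  haveI := W.isPerfPair_cupPairing hX i j h
  exact Module.finrank_of_isPerfPair (W.cupPairing X n i j h)

/-- `H⁰(X)` is one dimensional for a smooth projective (geometrically integral) `X`: by Poincaré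
duality `H⁰(X) ≅ (H²ⁿ(X))ᵛ ≅ K` (Kleiman 1968 §1.2 (A)). [cite: Kleiman1968, §1.2 (A)] -/
theorem finrank_obj_zero (hX : IsSmoothProjective n X) : Module.finrank K (W.obj X 0) = 1 := by
  rw [W.finrank_obj_eq_of_add_eq hX (i := 0) (j := 2 * n) (by omega)]
  exact W.finrank_obj_two_mul hX

end Sanity

end WeilCohomology

end Literature.AlgebraicGeometry.Motives

end
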